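import Mathlib

/-!
# The Marica–Schönheim pencil over EVERY field for families with least traces

Helper file for crux `stmt-CriticalPhenomena-4575` (`NoHeavyLowerTail`, route `PercNearOneGluingNoHeavy`),
new-inequality factory seat `prim-ineq-gen-3` (gen 24).  Everything here is PROVED; no definitions.
Pencil rows of a finite family `𝒜`: `C ↦ (E ↦ [E ⊆ C] + t [E ∩ C = ∅])` over `D = 𝒜 \\ 𝒜`.  They can be DEPENDENT over a
finite field with `t² ≠ 1` (the Fano plane over `ZMod 7`, file `…OrderedDifferencesFano`); here is a large class where they are
independent over every field, by a LOCAL argument (memo `FINDINGS-gen24.md`).  Fix `A ∈ 𝒜`, group the members `C` by their trace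
`C ∩ A`, `w(T) = ∑_{C ∩ A = T} c_C`.  The columns `A \ B` of a dependency read `∑_T w(T)([A \ B ⊆ T] + t[T ⊆ B ∩ A]) = 0`.  If every
co-filter `{traces X ⊇ A \ B}` has a LEAST element `φ(B ∩ A)` (e.g. traces closed under `∩`), then `[A \ B ⊆ T] = [φ T ⊆ B ∩ A]`,
the equations are lower sums over the trace poset of `g(W) = ∑_{φ T = W} w(T) + t w(W)`, so `g = 0`; and `φ∘φ∘φ = φ` (`φ` is
antitone with `φ φ T ⊆ T`) turns `∑_{φ T = W} w(T) = -t w(W)` into `-t w = -t³ w`, i.e. `w = 0` when `t ≠ 0`, `t² ≠ 1`.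
* `traceSum_eq_zero_of_leastTraces` — least traces at `A` ⟹ all trace-class sums of a dependency vanish at `A`;
* `linearIndependent_pencil_of_leastTraces` — every member has least traces ⟹ pencil rows independent over every field
  (`t ≠ 0`, `t * t ≠ 1`; `t = 0` is `linearIndependent_incidence_diffs_field`);
* `linearIndependent_pencil_of_leastTraces_maximal` — peeling form: every non-empty sub-family has a MAXIMAL member with least
  traces relative to it (≈ 95 % of random families on ≤ 6 points; the Fano plane has none: traces `{a},{b},{c},A`).
(prim-ineq-gen-3 gen 24, 2026-08-24.)
-/

namespace Summit.CriticalPhenomena.PercolationContinuityZ3.Theorems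

namespace OrderedDifferences

open Finset
open scoped FinsetFamily

variable {α : Type*} [DecidableEq α] {K : Type*} [Field K]

/-- Zeta invertibility (local copy of `eq_zero_of_sum_subsets_eq_zero`): lower sums vanish on `ℬ` ⟹ `κ = 0` on `ℬ`. -/
private theorem sum_subsets_zero_aux (ℬ : Finset (Finset α)) (κ : Finset α → K)
    (h : ∀ Y ∈ ℬ, ∑ X ∈ ℬ.filter (fun X => X ⊆ Y), κ X = 0) : ∀ X ∈ ℬ, κ X = 0 := by
  classical
  intro X₀ hX₀
  by_contra hne
  let S : Finset (Finset α) := ℬ.filter (fun X => κ X ≠ 0)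
  have hS : S.Nonempty := ⟨X₀, mem_filter.mpr ⟨hX₀, hne⟩⟩
  obtain ⟨Y, hYS, hYmin⟩ := exists_min_image S card hS
  have hYℬ : Y ∈ ℬ := (mem_filter.mp hYS).1
  have hκY : κ Y ≠ 0 := (mem_filter.mp hYS).2
  have hzero : ∀ X ∈ ℬ.filter (fun X => X ⊆ Y), X ≠ Y → κ X = 0 := by
    intro X hX hXY
    obtain ⟨hXℬ, hXY'⟩ := mem_filter.mp hX
    by_contra hκX
    have hcard : #Y ≤ #X := hYmin X (mem_filter.mpr ⟨hXℬ, hκX⟩)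
    exact hXY (eq_of_subset_of_card_le hXY' hcard)
  have hsum := h Y hYℬ
  have hYmem : Y ∈ ℬ.filter (fun X => X ⊆ Y) := mem_filter.mpr ⟨hYℬ, subset_rfl⟩
  rw [← add_sum_erase _ _ hYmem] at hsum
  have hrest : ∑ X ∈ (ℬ.filter (fun X => X ⊆ Y)).erase Y, κ X = 0 :=
    sum_eq_zero fun X hX => hzero X (mem_of_mem_erase hX) (ne_of_mem_erase hX)
  rw [hrest, add_zero] at hsum
  exact hκY hsum

/-- Zeta invertibility (local copy of `eq_zero_of_sum_supsets_eq_zero`): upper sums vanish on `ℬ` ⟹ `κ = 0` on `ℬ`. -/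
private theorem sum_supsets_zero_aux (ℬ : Finset (Finset α)) (κ : Finset α → K)
    (h : ∀ Y ∈ ℬ, ∑ X ∈ ℬ.filter (fun X => Y ⊆ X), κ X = 0) : ∀ X ∈ ℬ, κ X = 0 := by
  classical
  intro X₀ hX₀
  by_contra hne
  let S : Finset (Finset α) := ℬ.filter (fun X => κ X ≠ 0)
  have hS : S.Nonempty := ⟨X₀, mem_filter.mpr ⟨hX₀, hne⟩⟩
  obtain ⟨Y, hYS, hYmax⟩ := exists_max_image S card hS
  have hYℬ : Y ∈ ℬ := (mem_filter.mp hYS).1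
  have hκY : κ Y ≠ 0 := (mem_filter.mp hYS).2
  have hzero : ∀ X ∈ ℬ.filter (fun X => Y ⊆ X), X ≠ Y → κ X = 0 := by
    intro X hX hXY
    obtain ⟨hXℬ, hYX⟩ := mem_filter.mp hX
    by_contra hκX
    have hcard : #X ≤ #Y := hYmax X (mem_filter.mpr ⟨hXℬ, hκX⟩)
    exact hXY (eq_of_subset_of_card_le hYX hcard).symm
  have hsum := h Y hYℬ
  have hYmem : Y ∈ ℬ.filter (fun X => Y ⊆ X) := mem_filter.mpr ⟨hYℬ, subset_rfl⟩
  rw [← add_sum_erase _ _ hYmem] at hsum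
  have hrest : ∑ X ∈ (ℬ.filter (fun X => Y ⊆ X)).erase Y, κ X = 0 :=
    sum_eq_zero fun X hX => hzero X (mem_of_mem_erase hX) (ne_of_mem_erase hX)
  rw [hrest, add_zero] at hsum
  exact hκY hsum

/-- **Localization lemma with least traces.**  Let `A ∈ 𝒜` and let `φ` assign to every trace `B ∩ A` (`B ∈ 𝒜`) a trace
`φ (B ∩ A) = C ∩ A` which is the LEAST trace containing `A \ B` (it contains `A \ B`, and lies inside every member containing
`A \ B`).  If `c` is a dependency of the pencil rows at `t` (`t ≠ 0`, `t * t ≠ 1`), i.e.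
`∑_{C ∈ 𝒜} c_C ([E ⊆ C] + t [E ∩ C = ∅]) = 0` for all `E ∈ 𝒜 \\ 𝒜`, then every trace-class sum vanishes:
`∑_{C ∈ 𝒜, C ∩ A = B ∩ A} c_C = 0` for all `B ∈ 𝒜`. -/
theorem traceSum_eq_zero_of_leastTraces (𝒜 : Finset (Finset α)) {A : Finset α} (hA : A ∈ 𝒜)
    (φ : Finset α → Finset α)
    (hφmem : ∀ B ∈ 𝒜, ∃ C ∈ 𝒜, φ (B ∩ A) = C ∩ A)
    (hφsup : ∀ B ∈ 𝒜, A \ B ⊆ φ (B ∩ A))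
    (hφle : ∀ B ∈ 𝒜, ∀ C ∈ 𝒜, A \ B ⊆ C → φ (B ∩ A) ⊆ C)
    (c : Finset α → K) {t : K} (ht0 : t ≠ 0) (ht : t * t ≠ 1)
    (hdep : ∀ E ∈ 𝒜 \\ 𝒜, ∑ C ∈ 𝒜, c C * ((if E ⊆ C then (1 : K) else 0) +
      t * (if Disjoint E C then (1 : K) else 0)) = 0) :
    ∀ B ∈ 𝒜, ∑ C ∈ 𝒜.filter (fun C => C ∩ A = B ∩ A), c C = 0 := by
  classical
  set 𝒯 : Finset (Finset α) := 𝒜.image (· ∩ A) with h𝒯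
  let w : Finset α → K := fun T => ∑ C ∈ 𝒜.filter (fun C => C ∩ A = T), c C
  have hmapsA : ∀ C ∈ 𝒜, C ∩ A ∈ 𝒯 := fun C hC => mem_image_of_mem _ hC
  have hφT : ∀ T ∈ 𝒯, φ T ∈ 𝒯 := by
    intro T hT
    obtain ⟨B, hB, rfl⟩ := mem_image.mp hT
    obtain ⟨C, hC, hCe⟩ := hφmem B hB
    rw [hCe]; exact hmapsA C hC
  have hφA : ∀ T ∈ 𝒯, φ T ⊆ A := by
    intro T hT
    obtain ⟨B, hB, rfl⟩ := mem_image.mp hT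
    obtain ⟨C, hC, hCe⟩ := hφmem B hB
    rw [hCe]; exact inter_subset_right
  -- the key equivalence: for traces `X = B ∩ A` and `T = C ∩ A`:  `A \ B ⊆ C ↔ φ T ⊆ X`
  have hkey : ∀ B ∈ 𝒜, ∀ C ∈ 𝒜, (A \ B ⊆ C ↔ φ (C ∩ A) ⊆ B ∩ A) := by
    intro B hB C hC
    constructor
    · intro h
      -- `A \ C ⊆ B`, so the least trace containing `A \ C` lies inside `B`
      have h' : A \ C ⊆ B := by
        intro x hx
        rw [mem_sdiff] at hx
        by_contra hxB
        exact hx.2 (h (mem_sdiff.mpr ⟨hx.1, hxB⟩))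
      exact subset_inter (hφle C hC B hB h') (hφA _ (hmapsA C hC))
    · intro h x hx
      rw [mem_sdiff] at hx
      by_contra hxC
      have hx' : x ∈ φ (C ∩ A) := hφsup C hC (mem_sdiff.mpr ⟨hx.1, hxC⟩)
      exact hx.2 (mem_inter.mp (h hx')).1
  -- Step 1: the dependency at the column `A \ B`, grouped by traces
  have hstep1 : ∀ B ∈ 𝒜, ∑ T ∈ 𝒯, w T * ((if φ T ⊆ B ∩ A then (1 : K) else 0) +
      t * (if T ⊆ B ∩ A then (1 : K) else 0)) = 0 := by
    intro B hB
    have hE : A \ B ∈ 𝒜 \\ 𝒜 := mem_diffs.mpr ⟨A, hA, B, hB, rfl⟩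
    have h := hdep (A \ B) hE
    have h2 : ∑ C ∈ 𝒜, c C * ((if A \ B ⊆ C then (1 : K) else 0) +
        t * (if Disjoint (A \ B) C then (1 : K) else 0)) =
        ∑ C ∈ 𝒜, c C * ((if φ (C ∩ A) ⊆ B ∩ A then (1 : K) else 0) +
        t * (if C ∩ A ⊆ B ∩ A then (1 : K) else 0)) := by
      refine sum_congr rfl fun C hC => ?_
      have e1 : (A \ B ⊆ C) = (φ (C ∩ A) ⊆ B ∩ A) := propext (hkey B hB C hC)
      have e2 : Disjoint (A \ B) C ↔ C ∩ A ⊆ B ∩ A := by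
        rw [disjoint_left]
        constructor
        · intro hd x hx
          rw [mem_inter] at hx ⊢
          refine ⟨?_, hx.2⟩
          by_contra hxB
          exact hd (mem_sdiff.mpr ⟨hx.2, hxB⟩) hx.1
        · intro hs x hx hxC
          rw [mem_sdiff] at hx
          exact hx.2 (mem_inter.mp (hs (mem_inter.mpr ⟨hxC, hx.1⟩))).1
      simp only [e1, e2]
    rw [h2] at h
    rw [← sum_fiberwise_of_maps_to hmapsA] at h
    have e : ∑ T ∈ 𝒯, w T * ((if φ T ⊆ B ∩ A then (1 : K) else 0) +
        t * (if T ⊆ B ∩ A then (1 : K) else 0)) =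
        ∑ T ∈ 𝒯, ∑ C ∈ 𝒜.filter (fun C => C ∩ A = T), c C * ((if φ (C ∩ A) ⊆ B ∩ A then (1 : K) else 0) +
        t * (if C ∩ A ⊆ B ∩ A then (1 : K) else 0)) := by
      refine sum_congr rfl fun T _ => ?_
      rw [sum_mul]
      refine sum_congr rfl fun C hC => ?_
      rw [(mem_filter.mp hC).2]
    rw [e]
    exact h
  -- Step 2: as lower sums over the trace poset of `g W = (∑_{φ T = W} w T) + t w W`
  let g : Finset α → K := fun W => (∑ T ∈ 𝒯.filter (fun T => φ T = W), w T) + t * w W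
  have hstep2 : ∀ X ∈ 𝒯, ∑ W ∈ 𝒯.filter (fun W => W ⊆ X), g W = 0 := by
    intro X hX
    obtain ⟨B, hB, rfl⟩ := mem_image.mp hX
    have h := hstep1 B hB
    have e1 : ∑ T ∈ 𝒯, w T * (if φ T ⊆ B ∩ A then (1 : K) else 0) =
        ∑ W ∈ 𝒯.filter (fun W => W ⊆ B ∩ A), ∑ T ∈ 𝒯.filter (fun T => φ T = W), w T := by
      rw [← sum_fiberwise_of_maps_to hφT (f := fun T => w T * (if φ T ⊆ B ∩ A then (1 : K) else 0))]
      rw [sum_filter]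
      refine sum_congr rfl fun W _ => ?_
      split_ifs with hW
      · refine sum_congr rfl fun T hT => ?_
        rw [(mem_filter.mp hT).2, if_pos hW, mul_one]
      · refine sum_eq_zero fun T hT => ?_
        rw [(mem_filter.mp hT).2, if_neg hW, mul_zero]
    have e2 : ∑ T ∈ 𝒯, w T * (t * (if T ⊆ B ∩ A then (1 : K) else 0)) =
        ∑ W ∈ 𝒯.filter (fun W => W ⊆ B ∩ A), t * w W := by
      rw [sum_filter]
      refine sum_congr rfl fun T _ => ?_
      split_ifs <;> ring
    have e3 : ∑ T ∈ 𝒯, w T * ((if φ T ⊆ B ∩ A then (1 : K) else 0) +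
        t * (if T ⊆ B ∩ A then (1 : K) else 0)) =
        ∑ W ∈ 𝒯.filter (fun W => W ⊆ B ∩ A), g W := by
      simp only [mul_add]
      rw [sum_add_distrib, e1, e2, ← sum_add_distrib]
    rw [e3] at h
    exact h
  have hg : ∀ W ∈ 𝒯, g W = 0 := sum_subsets_zero_aux 𝒯 g hstep2
  have hN : ∀ W ∈ 𝒯, ∑ T ∈ 𝒯.filter (fun T => φ T = W), w T = -t * w W := by
    intro W hW
    have h := hg W hW
    simp only [g] at h
    linear_combination h
  -- Step 4: `φ ∘ φ ∘ φ = φ` on traces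
  have hφφ : ∀ T ∈ 𝒯, φ (φ T) ⊆ T := by
    intro T hT
    obtain ⟨C, hC, rfl⟩ := mem_image.mp hT
    obtain ⟨B', hB', hB'e⟩ := hφmem C hC
    have h1 : A \ B' ⊆ C := by
      intro x hx
      rw [mem_sdiff] at hx
      by_contra hxC
      have := hφsup C hC (mem_sdiff.mpr ⟨hx.1, hxC⟩)
      rw [hB'e] at this
      exact hx.2 (mem_inter.mp this).1
    rw [hB'e]
    exact subset_inter (hφle B' hB' C hC h1) (by rw [← hB'e]; exact hφA _ (hφT _ hT))
  have hanti : ∀ T₁ ∈ 𝒯, ∀ T₂ ∈ 𝒯, T₁ ⊆ T₂ → φ T₂ ⊆ φ T₁ := by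
    intro T₁ hT₁ T₂ hT₂ h12
    obtain ⟨C₁, hC₁, rfl⟩ := mem_image.mp hT₁
    obtain ⟨C₂, hC₂, rfl⟩ := mem_image.mp hT₂
    obtain ⟨B₁, hB₁, hB₁e⟩ := hφmem C₁ hC₁
    have h1 : A \ C₂ ⊆ B₁ := by
      intro x hx
      rw [mem_sdiff] at hx
      have hxC₁ : x ∉ C₁ := fun hxC₁ => hx.2 (mem_inter.mp (h12 (mem_inter.mpr ⟨hxC₁, hx.1⟩))).1
      have := hφsup C₁ hC₁ (mem_sdiff.mpr ⟨hx.1, hxC₁⟩)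
      rw [hB₁e] at this
      exact (mem_inter.mp this).1
    have h2 := hφle C₂ hC₂ B₁ hB₁ h1
    rw [hB₁e]
    exact subset_inter h2 (hφA _ (hmapsA C₂ hC₂))
  have hφ3 : ∀ T ∈ 𝒯, φ (φ (φ T)) = φ T := by
    intro T hT
    refine Subset.antisymm ?_ ?_
    · exact hφφ (φ T) (hφT T hT)
    · exact hanti _ (hφT _ (hφT T hT)) T hT (hφφ T hT)
  -- Step 5: iterate `N w = -t w` (generic step), giving `∑_{φ³ T = W} w T = -t³ w W`; compare with `φ³ = φ`
  have iter : ∀ (ψ : Finset α → Finset α) (s : K), (∀ T ∈ 𝒯, ψ T ∈ 𝒯) →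
      (∀ W ∈ 𝒯, ∑ T ∈ 𝒯.filter (fun T => ψ T = W), w T = s * w W) →
      ∀ W ∈ 𝒯, ∑ T ∈ 𝒯.filter (fun T => φ (ψ T) = W), w T = -t * s * w W := by
    intro ψ s hψ hs W hW
    have e : ∑ T ∈ 𝒯.filter (fun T => φ (ψ T) = W), w T =
        ∑ V ∈ 𝒯.filter (fun V => φ V = W), ∑ T ∈ 𝒯.filter (fun T => ψ T = V), w T := by
      rw [← sum_fiberwise_of_maps_to (s := 𝒯.filter (fun T => φ (ψ T) = W)) (t := 𝒯.filter (fun V => φ V = W))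
        (g := ψ) (fun T hT => mem_filter.mpr ⟨hψ T (mem_filter.mp hT).1, (mem_filter.mp hT).2⟩)]
      refine sum_congr rfl fun V hV => ?_
      have hVe : φ V = W := (mem_filter.mp hV).2
      refine sum_congr ?_ fun _ _ => rfl
      ext T
      simp only [mem_filter]
      constructor
      · rintro ⟨⟨hT, _⟩, hTV⟩; exact ⟨hT, hTV⟩
      · rintro ⟨hT, hTV⟩; exact ⟨⟨hT, by rw [hTV, hVe]⟩, hTV⟩
    rw [e, sum_congr rfl fun V hV => hs V (mem_filter.mp hV).1, ← mul_sum, hN W hW]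
    ring
  have hN2 := iter φ (-t) hφT hN
  have hN3 := iter (fun T => φ (φ T)) (-t * -t) (fun T hT => hφT _ (hφT T hT)) hN2
  have hw : ∀ W ∈ 𝒯, w W = 0 := by
    intro W hW
    have h1 := hN W hW
    have h3 := hN3 W hW
    have e : 𝒯.filter (fun T => φ (φ (φ T)) = W) = 𝒯.filter (fun T => φ T = W) := by
      ext T
      simp only [mem_filter]
      constructor
      · rintro ⟨hT, h⟩; exact ⟨hT, by rw [← hφ3 T hT]; exact h⟩
      · rintro ⟨hT, h⟩; exact ⟨hT, by rw [hφ3 T hT]; exact h⟩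
    rw [e, h1] at h3
    have h4 : t * (1 - t * t) * w W = 0 := by linear_combination -h3
    rcases mul_eq_zero.mp h4 with h5 | h5
    · rcases mul_eq_zero.mp h5 with h6 | h6
      · exact absurd h6 ht0
      · exact absurd (by linear_combination -h6) ht
    · exact h5
  intro B hB
  exact hw (B ∩ A) (hmapsA B hB)

/-- Choice of a least-trace map `φ` at `A` from the hypothesis "every co-filter of traces has a least element". -/
private theorem exists_leastTrace_map (ℬ : Finset (Finset α)) (A : Finset α)
    (h : ∀ B ∈ ℬ, ∃ X ∈ ℬ, A \ B ⊆ X ∧ ∀ C ∈ ℬ, A \ B ⊆ C → X ∩ A ⊆ C) :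
    ∃ φ : Finset α → Finset α, (∀ B ∈ ℬ, ∃ C ∈ ℬ, φ (B ∩ A) = C ∩ A) ∧ (∀ B ∈ ℬ, A \ B ⊆ φ (B ∩ A)) ∧
      ∀ B ∈ ℬ, ∀ C ∈ ℬ, A \ B ⊆ C → φ (B ∩ A) ⊆ C := by
  classical
  let φ : Finset α → Finset α := fun T =>
    if h : ∃ X ∈ ℬ, A \ T ⊆ X ∧ ∀ C ∈ ℬ, A \ T ⊆ C → X ∩ A ⊆ C then (Classical.choose h) ∩ A else ∅
  have hφspec : ∀ B ∈ ℬ, ∃ X ∈ ℬ, φ (B ∩ A) = X ∩ A ∧ A \ B ⊆ X ∧ ∀ C ∈ ℬ, A \ B ⊆ C → X ∩ A ⊆ C := by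
    intro B hB
    have hsd : A \ (B ∩ A) = A \ B := by
      ext x; simp only [mem_sdiff, mem_inter, not_and]; tauto
    have hex : ∃ X ∈ ℬ, A \ (B ∩ A) ⊆ X ∧ ∀ C ∈ ℬ, A \ (B ∩ A) ⊆ C → X ∩ A ⊆ C := by
      rw [hsd]; exact h B hB
    have hXs := Classical.choose_spec hex
    refine ⟨Classical.choose hex, hXs.1, ?_, ?_, ?_⟩
    · simp only [φ, dif_pos hex]
    · rw [← hsd]; exact hXs.2.1
    · intro C hC hC'; exact hXs.2.2 C hC (by rw [hsd]; exact hC')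
  refine ⟨φ, ?_, ?_, ?_⟩
  · intro B hB
    obtain ⟨X, hX, hXe, -, -⟩ := hφspec B hB
    exact ⟨X, hX, hXe⟩
  · intro B hB
    obtain ⟨X, hX, hXe, hsub, -⟩ := hφspec B hB
    rw [hXe]
    exact subset_inter hsub sdiff_subset
  · intro B hB C hC hBC
    obtain ⟨X, hX, hXe, -, hle⟩ := hφspec B hB
    rw [hXe]
    exact hle C hC hBC

/-- From a vanishing linear combination of the pencil rows to the pointwise dependency equations over `𝒜`. -/
private theorem dep_of_sum_smul_eq_zero (𝒜 : Finset (Finset α)) (t : K) (c : ↥𝒜 → K)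
    (hc : ∑ A : 𝒜, c A • (fun E : (𝒜 \\ 𝒜 : Finset (Finset α)) =>
      (if (E : Finset α) ⊆ (A : Finset α) then (1 : K) else 0) +
        t * (if Disjoint (E : Finset α) (A : Finset α) then (1 : K) else 0)) = 0) :
    ∀ E ∈ 𝒜 \\ 𝒜, ∑ C ∈ 𝒜, (fun C => if h : C ∈ 𝒜 then c ⟨C, h⟩ else 0) C *
      ((if E ⊆ C then (1 : K) else 0) + t * (if Disjoint E C then (1 : K) else 0)) = 0 := by
  classical
  intro E hE
  have h := congr_fun hc ⟨E, hE⟩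
  simp only [Finset.sum_apply, Pi.smul_apply, smul_eq_mul, Pi.zero_apply] at h
  have h' : ∑ x ∈ 𝒜.attach, c x * ((if E ⊆ (x : Finset α) then (1 : K) else 0) +
      t * (if Disjoint E (x : Finset α) then (1 : K) else 0)) = 0 := by
    rwa [← univ_eq_attach]
  rw [← sum_attach 𝒜]
  refine (sum_congr rfl fun A _ => ?_).trans h'
  have e : (fun C => if h : C ∈ 𝒜 then c ⟨C, h⟩ else 0) (A : Finset α) = c A := by
    simp only [dif_pos A.2]
  rw [e]

/-- **MS pencil over every field for families with least traces.**  Suppose that for every two members `A, B ∈ 𝒜` the traces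
`{C ∩ A : C ∈ 𝒜, A \ B ⊆ C}` have a least element (e.g. the traces of every member are closed under intersection).  Then for
every field `K` and every `t ∈ K` with `t ≠ 0` and `t * t ≠ 1`, the pencil rows `C ↦ (E ↦ [E ⊆ C] + t [E ∩ C = ∅])` over
`𝒜 \\ 𝒜` are linearly independent over `K`.  (The Fano plane, where the rows are dependent over `ZMod 7` at `t = 3`, has no
least trace at `B = A`.) -/
theorem linearIndependent_pencil_of_leastTraces (𝒜 : Finset (Finset α))
    (hlt : ∀ A ∈ 𝒜, ∀ B ∈ 𝒜, ∃ X ∈ 𝒜, A \ B ⊆ X ∧ ∀ C ∈ 𝒜, A \ B ⊆ C → X ∩ A ⊆ C)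
    {t : K} (ht0 : t ≠ 0) (ht : t * t ≠ 1) :
    LinearIndependent K (fun A : 𝒜 => fun E : (𝒜 \\ 𝒜 : Finset (Finset α)) =>
      (if (E : Finset α) ⊆ (A : Finset α) then (1 : K) else 0) +
        t * (if Disjoint (E : Finset α) (A : Finset α) then (1 : K) else 0)) := by
  classical
  rw [Fintype.linearIndependent_iff]
  intro c hc
  set c' : Finset α → K := fun C => if h : C ∈ 𝒜 then c ⟨C, h⟩ else 0 with hc'def
  have hc' : ∀ A : 𝒜, c' A = c A := fun A => by simp only [hc'def, dif_pos A.2]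
  have hdep := dep_of_sum_smul_eq_zero 𝒜 t c hc
  have hup : ∀ A ∈ 𝒜, ∑ C ∈ 𝒜.filter (fun C => A ⊆ C), c' C = 0 := by
    intro A hA
    obtain ⟨φ, hφmem, hφsup, hφle⟩ := exists_leastTrace_map 𝒜 A (hlt A hA)
    have h := traceSum_eq_zero_of_leastTraces 𝒜 hA φ hφmem hφsup hφle c' ht0 ht hdep A hA
    have e : 𝒜.filter (fun C => C ∩ A = A ∩ A) = 𝒜.filter (fun C => A ⊆ C) := by
      ext C
      simp only [mem_filter, inter_self, inter_eq_right]
    rw [e] at h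
    exact h
  have hzero := sum_supsets_zero_aux 𝒜 c' hup
  intro A
  rw [← hc' A]
  exact hzero A A.2

/-- **Peeling form.**  If every non-empty sub-family `ℬ ⊆ 𝒜` has a member `A` that is MAXIMAL in `ℬ` and has least traces
relative to `ℬ` (for every `B ∈ ℬ` the traces `{C ∩ A : C ∈ ℬ, A \ B ⊆ C}` have a least element), then for every field
`K` and `t ∈ K` with `t ≠ 0`, `t * t ≠ 1` the pencil rows of `𝒜` over `𝒜 \\ 𝒜` are linearly independent.
[Restrict a dependency to its support `ℬ`; the local lemma at the maximal member `A` gives `∑_{C ∈ ℬ, C ⊇ A} c_C = c_A = 0`.] -/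
theorem linearIndependent_pencil_of_leastTraces_maximal (𝒜 : Finset (Finset α))
    (hlt : ∀ ℬ ⊆ 𝒜, ℬ.Nonempty → ∃ A ∈ ℬ, (∀ C ∈ ℬ, A ⊆ C → C = A) ∧
      ∀ B ∈ ℬ, ∃ X ∈ ℬ, A \ B ⊆ X ∧ ∀ C ∈ ℬ, A \ B ⊆ C → X ∩ A ⊆ C)
    {t : K} (ht0 : t ≠ 0) (ht : t * t ≠ 1) :
    LinearIndependent K (fun A : 𝒜 => fun E : (𝒜 \\ 𝒜 : Finset (Finset α)) =>
      (if (E : Finset α) ⊆ (A : Finset α) then (1 : K) else 0) +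
        t * (if Disjoint (E : Finset α) (A : Finset α) then (1 : K) else 0)) := by
  classical
  rw [Fintype.linearIndependent_iff]
  intro c hc A₀
  set c' : Finset α → K := fun C => if h : C ∈ 𝒜 then c ⟨C, h⟩ else 0 with hc'def
  have hc' : ∀ A : 𝒜, c' A = c A := fun A => by simp only [hc'def, dif_pos A.2]
  have hdep := dep_of_sum_smul_eq_zero 𝒜 t c hc
  by_contra hA₀
  set ℬ : Finset (Finset α) := 𝒜.filter (fun C => c' C ≠ 0) with hℬdef
  have hℬsub : ℬ ⊆ 𝒜 := filter_subset _ _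
  have hℬne : ℬ.Nonempty := ⟨A₀, mem_filter.mpr ⟨A₀.2, by rw [hc' A₀]; exact hA₀⟩⟩
  obtain ⟨A, hA, hmax, hltA⟩ := hlt ℬ hℬsub hℬne
  have hDsub : ℬ \\ ℬ ⊆ 𝒜 \\ 𝒜 := diffs_subset hℬsub hℬsub
  have hdepB : ∀ E ∈ ℬ \\ ℬ, ∑ C ∈ ℬ, c' C * ((if E ⊆ C then (1 : K) else 0) +
      t * (if Disjoint E C then (1 : K) else 0)) = 0 := by
    intro E hE
    rw [hℬdef, sum_filter_of_ne (fun C _ h => by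
      intro h0; rw [h0, zero_mul] at h; exact h rfl)]
    exact hdep E (hDsub hE)
  obtain ⟨φ, hφmem, hφsup, hφle⟩ := exists_leastTrace_map ℬ A hltA
  have h := traceSum_eq_zero_of_leastTraces ℬ hA φ hφmem hφsup hφle c' ht0 ht hdepB A hA
  have e : ℬ.filter (fun C => C ∩ A = A ∩ A) = {A} := by
    ext C
    simp only [mem_filter, inter_self, inter_eq_right, mem_singleton]
    constructor
    · rintro ⟨hC, hAC⟩; exact hmax C hC hAC
    · rintro rfl; exact ⟨hA, subset_rfl⟩
  rw [e, sum_singleton] at h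
  exact (mem_filter.mp hA).2 h

end OrderedDifferences

end Summit.CriticalPhenomena.PercolationContinuityZ3.Theorems
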